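import Mathlib.Algebra.BigOperators.Intervals
import Literature.InformationTheory.Entropy.MapEntropyPi
import Literature.InformationTheory.Coding.SourcePolarization
import HarnessLib

/-!
# The conservation law (chain rule) of Arıkan source polarization

Discharges the named fact `Literature.InformationTheory.Coding.Polar.ChainRule` of
`Literature/InformationTheory/Coding/SourcePolarization.lean` (`theorem ChainRule_holds`): for every
binary source with functional side information `g : F₂ → F₂^m → β` and every `s` (`t = 2^s` copies,
`U = B^t · F^{⊗s}` the polar transform of the copies' source bits, `Y^t` their side information),
`Σ_{j < 2^s} H(U_j | U_{<j}, Y^t) = 2^s · H(B | Y)`, printed as `H(U^N | Y^N) = N · H(X | Y)`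
[Arıkan 2010, §III, the display before Thm 1] — the chain rule for entropy [Cover–Thomas,
Thm 2.5.1] followed by invertibility of the polar transform and independence of the copies.

## Proof (finitary, `mapEntropy` only)

Write `a k = H((U_{<k}, Y^t))`, where `U_{<k}` is the vector of polarized bits masked above index
`k` (entries `j' ≥ k` zeroed).  The `j`-th leakage is `H((U_j, U_{<j}, Y^t)) − H((U_{<j}, Y^t))`,
and `(U_j, U_{<j}, Y^t)` and `(U_{<j+1}, Y^t)` determine each other (`masked_succ_eq_iff`), so it
equals `a (j+1) − a j` (`leak_eq_sub`; entropy only depends on the kernel,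
`mapEntropy_univ_eq_of_ker_eq`) and the sum telescopes to `a (2^s) − a 0`.  At `k = 0` the mask
hides everything and `a 0 = H(Y^t) = 2^s · H(Y)`; at `k = 2^s` nothing is masked and, the polar
transform `b ↦ (polarBit s j b)_j` being injective (`polarBit_injective`: the matrix
`[i AND j = j]` is unitriangular, `i AND j = j → j ≤ i`),
`a (2^s) = H((B^t, Y^t)) = 2^s · H((B, Y))`; both by the product rule for independent copies
(`mapEntropy_pi`).  The difference is `2^s · (H((B,Y)) − H(Y)) = 2^s · H(B | Y)`.

## References

* E. Arıkan, *Source polarization*, Proc. IEEE ISIT 2010, 899–903, §III.  bib `Arikan2010`.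
* T. M. Cover, J. A. Thomas, *Elements of Information Theory*, 2nd ed., Wiley 2006, Thm 2.5.1
  (chain rule for entropy), Thm 2.6.6.  bib `CoverThomas2006`.
-/

namespace Literature.InformationTheory.Coding.Polar

open Finset Literature.InformationTheory.Entropy

variable {m : ℕ} {β : Type} [DecidableEq β]

/-! ### The polar transform is injective -/

/-- **The polar transform `b ↦ b · F^{⊗s}` is injective on `F₂^{2^s}`.**  Its matrix
`(F^{⊗s})_{ij} = [i AND j = j]` is unitriangular: `i AND j = j` forces `j ≤ i`, and the diagonal
entries are `1` (`j AND j = j`); so if `b ≠ b'` and `i₀` is the LARGEST index where they differ,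
row `i₀` of the transform differs too (`u_{i₀} − u'_{i₀} = b_{i₀} − b'_{i₀}`).
[cite: Arikan2009, §VII (G_N = B_N F^{⊗n} is a bijection of F₂^N)] -/
theorem polarBit_injective (s : ℕ) :
    Function.Injective fun (b : Fin (2 ^ s) → ZMod 2) (j : Fin (2 ^ s)) => polarBit s j b := by
  intro b b' h
  by_contra hne
  obtain ⟨i₁, hi₁⟩ : ∃ i, b i ≠ b' i := Function.ne_iff.1 hne
  -- the largest index of disagreement
  obtain ⟨i₀, hi₀D, hmax⟩ := (univ.filter fun i : Fin (2 ^ s) => b i ≠ b' i).exists_max_image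
    (fun i => i) ⟨i₁, by simpa using hi₁⟩
  have hi₀ : b i₀ ≠ b' i₀ := by simpa using hi₀D
  have habove : ∀ i : Fin (2 ^ s), i₀ < i → b i = b' i := by
    intro i hi
    by_contra hne'
    exact absurd (hmax i (by simpa using hne')) (not_le.2 hi)
  have hrow : polarBit s i₀ b = polarBit s i₀ b' := congr_fun h i₀
  unfold polarBit at hrow
  rw [← sub_eq_zero, ← Finset.sum_sub_distrib, Finset.sum_eq_single i₀] at hrow
  · simp only [Nat.and_self, if_true] at hrow
    exact hi₀ (sub_eq_zero.1 hrow)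
  · intro i _ hne'
    by_cases hc : i.val &&& i₀.val = i₀.val
    · have hle : i₀.val ≤ i.val := by
        have hand : i.val &&& i₀.val ≤ i.val := Nat.and_le_left
        rwa [hc] at hand
      have hlt : i₀ < i := lt_of_le_of_ne (Fin.le_def.2 hle) (Ne.symm hne')
      rw [if_pos hc, if_pos hc, habove i hlt, sub_self]
    · rw [if_neg hc, if_neg hc, sub_self]
  · intro hi₀
    exact absurd (mem_univ _) hi₀

/-! ### Telescoping -/

/-- Revealing one more coordinate of a masked vector: the vectors `u`, `u'` masked above index
`j + 1` agree iff their `j`-th entries agree and they agree masked above index `j`. [folklore] -/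
theorem masked_succ_eq_iff {n : ℕ} (u u' : Fin n → ZMod 2) (j : Fin n) :
    ((fun j' : Fin n => if j'.val < j.val + 1 then u j' else 0) =
        fun j' : Fin n => if j'.val < j.val + 1 then u' j' else 0) ↔
      u j = u' j ∧ (fun j' : Fin n => if j'.val < j.val then u j' else 0) =
        fun j' : Fin n => if j'.val < j.val then u' j' else 0 := by
  simp only [funext_iff]
  constructor
  · intro h
    refine ⟨by simpa using h j, fun j' => ?_⟩
    by_cases hlt : j'.val < j.val
    · have hj' := h j'
      rw [if_pos (Nat.lt_succ_of_lt hlt), if_pos (Nat.lt_succ_of_lt hlt)] at hj'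
      rw [if_pos hlt, if_pos hlt]
      exact hj'
    · rw [if_neg hlt, if_neg hlt]
  · rintro ⟨hj, h⟩ j'
    by_cases hlt : j'.val < j.val + 1
    · rw [if_pos hlt, if_pos hlt]
      by_cases hlt' : j'.val < j.val
      · have hj' := h j'
        rwa [if_pos hlt', if_pos hlt'] at hj'
      · have hjj : j' = j := Fin.ext (by omega)
        rw [hjj]
        exact hj
    · rw [if_neg hlt, if_neg hlt]

omit [DecidableEq β] in
/-- The conditioning data `ctx g s j X = (U_{<j}, Y^t)` with the mask written on `ℕ`-indices
(`j'.val < j.val`; definitionally the same as `j' < j`). [folklore] -/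
theorem ctx_eq (g : ZMod 2 → (Fin m → ZMod 2) → β) (s : ℕ) (j : Fin (2 ^ s)) (X : Cfg s m) :
    ctx g s j X = ((fun j' : Fin (2 ^ s) =>
        if j'.val < j.val then polarBit s j' (fun c => (X c).1) else 0),
      fun c => g (X c).1 (X c).2) :=
  rfl

/-- **One summand of the chain rule is a difference of consecutive prefix entropies**:
`H(U_j | U_{<j}, Y^t) = H((U_{<j+1}, Y^t)) − H((U_{<j}, Y^t))`, because `(U_j, U_{<j}, Y^t)` and
`(U_{<j+1}, Y^t)` are recodings of each other (equal kernels). [folklore] -/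
theorem leak_eq_sub (g : ZMod 2 → (Fin m → ZMod 2) → β) (s : ℕ) (j : Fin (2 ^ s)) :
    leak g s j =
      mapEntropy univ (fun X : Cfg s m => ((fun j' : Fin (2 ^ s) =>
          if j'.val < j.val + 1 then polarBit s j' (fun c => (X c).1) else 0),
        fun c => g (X c).1 (X c).2)) -
      mapEntropy univ (fun X : Cfg s m => ((fun j' : Fin (2 ^ s) =>
          if j'.val < j.val then polarBit s j' (fun c => (X c).1) else 0),
        fun c => g (X c).1 (X c).2)) := by
  have h1 : mapEntropy univ (fun X : Cfg s m => (tgt s j X, ctx g s j X)) =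
      mapEntropy univ (fun X : Cfg s m => ((fun j' : Fin (2 ^ s) =>
          if j'.val < j.val + 1 then polarBit s j' (fun c => (X c).1) else 0),
        fun c => g (X c).1 (X c).2)) := by
    refine mapEntropy_univ_eq_of_ker_eq fun X X' => ?_
    rw [tgt, tgt, ctx_eq, ctx_eq, Prod.mk.injEq, Prod.mk.injEq, Prod.mk.injEq, masked_succ_eq_iff,
      and_assoc]
  have h2 : mapEntropy univ (ctx g s j) =
      mapEntropy univ (fun X : Cfg s m => ((fun j' : Fin (2 ^ s) =>
          if j'.val < j.val then polarBit s j' (fun c => (X c).1) else 0),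
        fun c => g (X c).1 (X c).2)) := rfl
  rw [leak, h1, h2]

/-! ### The two ends of the telescope -/

/-- **Fully masked end**: `H((U_{<0}, Y^t)) = H(Y^t) = 2^s · H(Y)` (the mask hides every polarized
bit; product rule for the `2^s` independent copies of `Y = g B W'`). [folklore] -/
theorem mapEntropy_masked_zero (g : ZMod 2 → (Fin m → ZMod 2) → β) (s : ℕ) :
    mapEntropy univ (fun X : Cfg s m => ((fun j' : Fin (2 ^ s) =>
          if j'.val < 0 then polarBit s j' (fun c => (X c).1) else 0),
        fun c => g (X c).1 (X c).2)) =
      2 ^ s * mapEntropy univ (fun p : ZMod 2 × (Fin m → ZMod 2) => g p.1 p.2) := by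
  have h := mapEntropy_pi (fun p : ZMod 2 × (Fin m → ZMod 2) => g p.1 p.2) (2 ^ s)
  push_cast at h
  rw [← h]
  refine mapEntropy_univ_eq_of_ker_eq fun X X' => ?_
  simp

/-- **Unmasked end**: `H((U_{<2^s}, Y^t)) = H((U, Y^t)) = H((B^t, Y^t)) = 2^s · H((B, Y))` (nothing
is masked; the polar transform is injective, so `(U, Y^t)` and `(B^t, Y^t) = ((B, Y)^{(c)})_c` have
the same kernel; product rule for the `2^s` independent copies of `(B, Y)`). [folklore] -/
theorem mapEntropy_masked_full (g : ZMod 2 → (Fin m → ZMod 2) → β) (s : ℕ) :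
    mapEntropy univ (fun X : Cfg s m => ((fun j' : Fin (2 ^ s) =>
          if j'.val < 2 ^ s then polarBit s j' (fun c => (X c).1) else 0),
        fun c => g (X c).1 (X c).2)) =
      2 ^ s * mapEntropy univ (fun p : ZMod 2 × (Fin m → ZMod 2) => (p.1, g p.1 p.2)) := by
  have h := mapEntropy_pi (fun p : ZMod 2 × (Fin m → ZMod 2) => (p.1, g p.1 p.2)) (2 ^ s)
  push_cast at h
  rw [← h]
  refine mapEntropy_univ_eq_of_ker_eq fun X X' => ?_
  simp only [Fin.is_lt, if_true, Prod.mk.injEq]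
  constructor
  · rintro ⟨h1, h2⟩
    have hB : (fun c => (X c).1) = fun c => (X' c).1 := polarBit_injective s h1
    funext c
    exact Prod.ext (congr_fun hB c) (congr_fun h2 c)
  · intro h'
    have hc : ∀ c, (X c).1 = (X' c).1 ∧ g (X c).1 (X c).2 = g (X' c).1 (X' c).2 := fun c =>
      Prod.mk.inj (congr_fun h' c)
    have hB : (fun c => (X c).1) = fun c => (X' c).1 := funext fun c => (hc c).1
    exact ⟨by rw [hB], funext fun c => (hc c).2⟩

/-! ### The chain rule -/

/-- **Conservation law of source polarization (chain rule)** — discharges the named fact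
`ChainRule`: for every binary source with functional side information `g` and every `s`,
`Σ_{j < 2^s} H(U_j | U_{<j}, Y^t) = 2^s · H(B | Y)`.  The sum telescopes (`leak_eq_sub`) to
`H((U, Y^t)) − H(Y^t)`, whose ends are `2^s · H((B,Y))` (`mapEntropy_masked_full`, injectivity of
the polar transform) and `2^s · H(Y)` (`mapEntropy_masked_zero`).  Printed as
`H(U^N | Y^N) = N · H(X | Y)`. [cite: Arikan2010, §III eq. before Thm 1 (H(U^N|Y^N) = N H(X|Y))] -/
theorem ChainRule_holds : ChainRule := by
  intro m β _ g s
  -- prefix entropies `a k = H((U_{<k}, Y^t))`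
  set a : ℕ → ℝ := fun k => mapEntropy univ (fun X : Cfg s m => ((fun j' : Fin (2 ^ s) =>
          if j'.val < k then polarBit s j' (fun c => (X c).1) else 0),
        fun c => g (X c).1 (X c).2)) with ha
  have hleak : ∀ j : Fin (2 ^ s), leak g s j = a (j.val + 1) - a j.val := fun j => by
    simp only [ha]
    exact leak_eq_sub g s j
  have hfull : a (2 ^ s) =
      2 ^ s * mapEntropy univ (fun p : ZMod 2 × (Fin m → ZMod 2) => (p.1, g p.1 p.2)) := by
    simp only [ha]
    exact mapEntropy_masked_full g s
  have hzero : a 0 = 2 ^ s * mapEntropy univ (fun p : ZMod 2 × (Fin m → ZMod 2) => g p.1 p.2) := by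
    simp only [ha]
    exact mapEntropy_masked_zero g s
  calc ∑ j : Fin (2 ^ s), leak g s j = ∑ j : Fin (2 ^ s), (a (j.val + 1) - a j.val) :=
        Finset.sum_congr rfl fun j _ => hleak j
    _ = ∑ k ∈ range (2 ^ s), (a (k + 1) - a k) :=
        Fin.sum_univ_eq_sum_range (fun k => a (k + 1) - a k) (2 ^ s)
    _ = a (2 ^ s) - a 0 := Finset.sum_range_sub a (2 ^ s)
    _ = 2 ^ s * condEnt g := by rw [hfull, hzero, condEnt]; ring

end Literature.InformationTheory.Coding.Polar
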